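import Mathlib
import Literature.Analysis.Calculus.SmoothCutoff
import Literature.Analysis.FluidPDE.Wei2016HardyCutoff
import HarnessLib

/-!
# Galdi's Liouville problem ⟨0895⟩, line «all-axes cylinder budget», piece O1c (2/·):
# smooth steps, the axial cut-off, and the arithmetic of the radial profile

Route `GaldiLiouvilleGate` (NavierStokesRegularity), items ⟨0895⟩/⟨0896⟩; LINE allaxes/cylbudget, combined
Defs v3.1 (pub/ideators/ns-idea-4/lines/combined/CylinderBudgets_v3_1.lean 817120c4c833a18a), obligation
O1c′ `CylinderBookkeepingSplit` (BLUEPRINT Remark 15, «the tested identity with ψ = G(r)χ(z/L) and the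
profile G′ = r ∧ t²/r, tapered on [R, 2R]»).  Pure one-variable calculus, no fluid content:

* `exists_bound_deriv_deriv_smoothTransition` — `|sT′|, |sT″| ≤ D` on `ℝ` (on the tree's `Wei2016` second-derivative lemmas);
* `exists_zCutoff` — the axial plateau cut-off `χ_Z = cutoff (Z+1)`: `= 1` on `|z| ≤ Z`, `= 0` on
  `|z| ≥ Z + 1`, values in `[0,1]`, `|χ′|, |χ″| ≤ D` uniformly in `Z`;
* `hasDerivAt_radialN`, `radialN_transition_arith`, `radialN_taper_arith`, `radialPrimitive_props` —
  the derivative of the model profile `N = (φ + (1−φ)c₁/s)·η`, the crude transition-layer bounds, the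
  taper identities/bounds, and the primitive `M = ½∫_{a}^{s} N` (used by `exists_radialProfile` in
  `…AllAxesBudgetProfile`).

[folklore]  No summit / no ⟨0895⟩–⟨0896⟩ claim is proved here; NS regularity is not touched.
-/

noncomputable section

-- the problem directory repeats the summit name (D-0017); core's `dupNamespace` linter fires
set_option linter.dupNamespace false

open MeasureTheory Set Filter Topology Function
open scoped Topology Interval

namespace Summit.NavierStokesRegularity.NavierStokesRegularity.Theorems.GaldiLiouville.AllAxesBudget

open Literature.Analysis.Calculus Literature.Analysis.FluidPDE

/-! ### Second derivative of the smooth transition -/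

/-- **`|sT′| ≤ D` and `|sT″| ≤ D`** on `ℝ` for one absolute constant `D` (both derivatives are continuous
and vanish off `[0, 1]`). [folklore] -/
theorem exists_bound_deriv_deriv_smoothTransition : ∃ D : ℝ, 0 ≤ D ∧
    (∀ t, |deriv Real.smoothTransition t| ≤ D) ∧ ∀ t, |deriv (deriv Real.smoothTransition) t| ≤ D := by
  obtain ⟨D₁, hD₁, h₁⟩ := exists_bound_deriv_smoothTransition
  have hc : Continuous (deriv (deriv Real.smoothTransition)) :=
    (Wei2016.contDiff_deriv_smoothTransition (n := 1)).continuous_deriv le_rfl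
  obtain ⟨C, hC⟩ := isCompact_Icc.exists_bound_of_continuousOn (hc.continuousOn (s := Icc 0 1))
  refine ⟨max D₁ (max C 0), le_max_of_le_right (le_max_right _ _), fun t => (h₁ t).trans (le_max_left _ _),
    fun t => ?_⟩
  by_cases ht : t ∈ Icc (0 : ℝ) 1
  · exact ((Real.norm_eq_abs _).symm.le.trans (hC t ht)).trans
      ((le_max_left _ _).trans (le_max_right _ _))
  · have h0 : deriv (deriv Real.smoothTransition) t = 0 := by
      simp only [mem_Icc, not_and_or, not_le] at ht
      rcases ht with ht | ht
      · exact Wei2016.deriv_deriv_smoothTransition_of_nonpos ht.le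
      · exact Wei2016.deriv_deriv_smoothTransition_of_one_le ht.le
    rw [h0, abs_zero]
    exact le_max_of_le_right (le_max_right _ _)

/-! ### The axial plateau cut-off -/

/-- **The axial cut-off family.**  There is an absolute `D ≥ 0` such that for every `Z ≥ 0` the smooth
plateau cut-off `χ = cutoff (Z + 1)` satisfies: `χ = 1` on `|z| ≤ Z`, `χ = 0` on `|z| ≥ Z + 1`,
`0 ≤ χ ≤ 1`, compact support, and `|χ′|, |χ″| ≤ D` everywhere. [folklore] -/
theorem exists_zCutoff : ∃ D : ℝ, 0 ≤ D ∧ ∀ Z : ℝ, 0 ≤ Z → ∃ χ : ℝ → ℝ,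
    ContDiff ℝ (⊤ : ℕ∞) χ ∧ HasCompactSupport χ ∧ (∀ z, |z| ≤ Z → χ z = 1) ∧ (∀ z, Z + 1 ≤ |z| → χ z = 0) ∧
    (∀ z, 0 ≤ χ z ∧ χ z ≤ 1) ∧ (∀ z, |deriv χ z| ≤ D) ∧ ∀ z, |deriv (deriv χ) z| ≤ D := by
  obtain ⟨D, hD0, hD1, hD2⟩ := exists_bound_deriv_deriv_smoothTransition
  refine ⟨2 * D + 2 * D ^ 2, by positivity, fun Z hZ => ⟨cutoff (Z + 1), contDiff_cutoff _, ?_, ?_, ?_, ?_, ?_, ?_⟩⟩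
  · refine HasCompactSupport.of_support_subset_isCompact (isCompact_Icc (a := -(Z + 1)) (b := Z + 1)) ?_
    intro z hz
    by_contra h
    simp only [mem_Icc, not_and_or, not_le] at h
    refine hz (cutoff_eq_zero ?_)
    rcases h with h | h
    · rw [abs_of_neg (by linarith)]; linarith
    · rw [abs_of_pos (by linarith)]; linarith
  · intro z hz; exact cutoff_eq_one (by linarith)
  · intro z hz; exact cutoff_eq_zero hz
  · intro z; exact ⟨cutoff_nonneg _ _, cutoff_le_one _ _⟩
  · intro z
    rw [deriv_cutoff]
    have ha := hD1 (z + (Z + 1)); have hb := hD1 (Z + 1 - z)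
    have h0a := Real.smoothTransition.nonneg (z + (Z + 1)); have h1a := Real.smoothTransition.le_one (z + (Z + 1))
    have h0b := Real.smoothTransition.nonneg (Z + 1 - z); have h1b := Real.smoothTransition.le_one (Z + 1 - z)
    rw [abs_le] at ha hb ⊢
    constructor <;> nlinarith
  · intro z
    -- the second derivative in closed form
    set sT := Real.smoothTransition with hsT
    set R : ℝ := Z + 1 with hR
    have hd : deriv (cutoff R) = fun s => deriv sT (s + R) * sT (R - s) - sT (s + R) * deriv sT (R - s) :=
      funext fun s => deriv_cutoff R s
    have h1 : ∀ s, HasDerivAt (fun s => sT (s + R)) (deriv sT (s + R)) s := fun s =>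
      (differentiable_smoothTransition (s + R)).hasDerivAt.comp_add_const s R
    have h2 : ∀ s, HasDerivAt (fun s => sT (R - s)) (-deriv sT (R - s)) s := fun s =>
      (differentiable_smoothTransition (R - s)).hasDerivAt.comp_const_sub R s
    have h1' : ∀ s, HasDerivAt (fun s => deriv sT (s + R)) (deriv (deriv sT) (s + R)) s := fun s =>
      (Wei2016.differentiable_deriv_smoothTransition (s + R)).hasDerivAt.comp_add_const s R
    have h2' : ∀ s, HasDerivAt (fun s => deriv sT (R - s)) (-deriv (deriv sT) (R - s)) s := fun s =>
      (Wei2016.differentiable_deriv_smoothTransition (R - s)).hasDerivAt.comp_const_sub R s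
    have hdd : HasDerivAt (deriv (cutoff R))
        (deriv (deriv sT) (z + R) * sT (R - z) + deriv sT (z + R) * (-deriv sT (R - z)) -
          (deriv sT (z + R) * deriv sT (R - z) + sT (z + R) * (-deriv (deriv sT) (R - z)))) z := by
      rw [hd]
      exact ((h1' z).mul (h2 z)).sub ((h1 z).mul (h2' z))
    rw [hdd.deriv]
    have hsT1 : ∀ u, |sT u| ≤ 1 := fun u => by
      rw [abs_of_nonneg (Real.smoothTransition.nonneg u)]; exact Real.smoothTransition.le_one u
    have hp1 : |deriv (deriv sT) (z + R) * sT (R - z)| ≤ D := by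
      rw [abs_mul]
      calc |deriv (deriv sT) (z + R)| * |sT (R - z)| ≤ D * 1 :=
            mul_le_mul (hD2 _) (hsT1 _) (abs_nonneg _) hD0
        _ = D := mul_one D
    have hp2 : |deriv sT (z + R) * deriv sT (R - z)| ≤ D * D := by
      rw [abs_mul]; exact mul_le_mul (hD1 _) (hD1 _) (abs_nonneg _) hD0
    have hp3 : |sT (z + R) * deriv (deriv sT) (R - z)| ≤ D := by
      rw [abs_mul]
      calc |sT (z + R)| * |deriv (deriv sT) (R - z)| ≤ 1 * D :=
            mul_le_mul (hsT1 _) (hD2 _) (abs_nonneg _) zero_le_one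
        _ = D := one_mul D
    have hE : deriv (deriv sT) (z + R) * sT (R - z) + deriv sT (z + R) * -deriv sT (R - z) -
        (deriv sT (z + R) * deriv sT (R - z) + sT (z + R) * -deriv (deriv sT) (R - z)) =
        deriv (deriv sT) (z + R) * sT (R - z) - 2 * (deriv sT (z + R) * deriv sT (R - z)) +
          sT (z + R) * deriv (deriv sT) (R - z) := by ring
    rw [hE]
    obtain ⟨a1, a2⟩ := abs_le.1 hp1
    obtain ⟨b1, b2⟩ := abs_le.1 hp2
    obtain ⟨c1, c2⟩ := abs_le.1 hp3
    rw [abs_le]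
    constructor <;> nlinarith


/-! ### The radial profile -/

/-- `deriv` of `s ↦ sT((a - s)/d)`. [folklore] -/
theorem hasDerivAt_smoothTransition_affine (a d s : ℝ) :
    HasDerivAt (fun σ => Real.smoothTransition ((a - σ) / d))
      (deriv Real.smoothTransition ((a - s) / d) * (-1 / d)) s := by
  have h1 : HasDerivAt (fun σ : ℝ => (a - σ) / d) (-1 / d) s := by
    have := ((hasDerivAt_id s).const_sub a).div_const d
    simpa using this
  exact (differentiable_smoothTransition _).hasDerivAt.comp s h1

/-- Derivative of the model profile `N(σ) = (φ(σ) + (1 − φ(σ)) c₁/σ) · η(σ)` at `s ≠ 0`. [folklore] -/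
theorem hasDerivAt_radialN {φ η : ℝ → ℝ} {c₁ s φ' η' : ℝ} (hφ : HasDerivAt φ φ' s)
    (hη : HasDerivAt η η' s) (hs : s ≠ 0) :
    HasDerivAt (fun σ => (φ σ + (1 - φ σ) * (c₁ / σ)) * η σ)
      ((φ' + (-φ' * (c₁ / s) + (1 - φ s) * (-(c₁ / s ^ 2)))) * η s +
        (φ s + (1 - φ s) * (c₁ / s)) * η') s := by
  have h2 : HasDerivAt (fun σ : ℝ => c₁ / σ) (-(c₁ / s ^ 2)) s := by
    have h := (hasDerivAt_inv hs).const_mul c₁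
    have e : (fun σ : ℝ => c₁ / σ) = fun σ => c₁ * σ⁻¹ := funext fun σ => div_eq_mul_inv _ _
    rw [e]
    exact h.congr_deriv (by rw [div_eq_mul_inv]; ring)
  have h3 : HasDerivAt (fun σ => 1 - φ σ) (-φ') s := by simpa using hφ.const_sub 1
  exact (hφ.add (h3.mul h2)).mul hη

/-- **Transition-layer arithmetic** (`η = 1`, `η′ = 0`, `φ ∈ [0,1]`, `|φ′| |s − c₁| ≤ D`, `0 ≤ c₁/s ≤ 4`):
the derivative value `v` of `hasDerivAt_radialN` obeys `|s v| ≤ D + 4` and `|N(s) + s v| ≤ D + 8`. [folklore] -/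
theorem radialN_transition_arith {φs φ' c₁ s D : ℝ} (hs : 0 < s) (hφ0 : 0 ≤ φs) (hφ1 : φs ≤ 1)
    (hD : |φ' * (s - c₁)| ≤ D) (hc0 : 0 ≤ c₁ / s) (hc4 : c₁ / s ≤ 4) :
    |s * ((φ' + (-φ' * (c₁ / s) + (1 - φs) * (-(c₁ / s ^ 2)))) * 1 + (φs + (1 - φs) * (c₁ / s)) * 0)| ≤ D + 4 ∧
    |(φs + (1 - φs) * (c₁ / s)) * 1 +
        s * ((φ' + (-φ' * (c₁ / s) + (1 - φs) * (-(c₁ / s ^ 2)))) * 1 + (φs + (1 - φs) * (c₁ / s)) * 0)|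
      ≤ D + 8 := by
  have hid : s * ((φ' + (-φ' * (c₁ / s) + (1 - φs) * (-(c₁ / s ^ 2)))) * 1 + (φs + (1 - φs) * (c₁ / s)) * 0)
      = φ' * (s - c₁) - (1 - φs) * (c₁ / s) := by
    field_simp; ring
  have hb2 : 0 ≤ (1 - φs) * (c₁ / s) ∧ (1 - φs) * (c₁ / s) ≤ 4 := ⟨by nlinarith, by nlinarith⟩
  obtain ⟨a1, a2⟩ := abs_le.1 hD
  rw [hid]
  refine ⟨abs_le.2 ⟨by linarith, by linarith⟩, abs_le.2 ⟨by nlinarith, by nlinarith⟩⟩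

/-- **Taper arithmetic** (`φ = 0`, `φ′ = 0`, `η ∈ [0,1]`, `η′ ≤ 0`, `|η′| ≤ D/(3T²)`, `T² ≤ s ≤ 4T²`): with
the derivative value `v` of `hasDerivAt_radialN`, `N + s v = c₁ η′`, `−s² v = c₁ η − c₁ s η′ ∈ [0, c₁(1 + 4D/3)]`,
`|N + s v| ≤ c₁ D/(3T²)`. [folklore] -/
theorem radialN_taper_arith {ηs η' c₁ s D T : ℝ} (hT : 0 < T) (hc : 0 ≤ c₁) (hs : T ^ 2 ≤ s) (hs' : s ≤ 4 * T ^ 2)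
    (hη0 : 0 ≤ ηs) (hη1 : ηs ≤ 1) (hη' : η' ≤ 0) (hη'b : |η'| ≤ D / (3 * T ^ 2)) :
    |(0 + (1 - 0) * (c₁ / s)) * ηs +
        s * ((0 + (-0 * (c₁ / s) + (1 - 0) * (-(c₁ / s ^ 2)))) * ηs + (0 + (1 - 0) * (c₁ / s)) * η')|
      ≤ c₁ * (D / (3 * T ^ 2)) ∧
    0 ≤ -(s ^ 2 * ((0 + (-0 * (c₁ / s) + (1 - 0) * (-(c₁ / s ^ 2)))) * ηs + (0 + (1 - 0) * (c₁ / s)) * η')) ∧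
    -(s ^ 2 * ((0 + (-0 * (c₁ / s) + (1 - 0) * (-(c₁ / s ^ 2)))) * ηs + (0 + (1 - 0) * (c₁ / s)) * η'))
      ≤ c₁ * (1 + 4 * D / 3) := by
  have hs0 : 0 < s := lt_of_lt_of_le (by positivity) hs
  have hid1 : (0 + (1 - 0) * (c₁ / s)) * ηs +
      s * ((0 + (-0 * (c₁ / s) + (1 - 0) * (-(c₁ / s ^ 2)))) * ηs + (0 + (1 - 0) * (c₁ / s)) * η') = c₁ * η' := by
    field_simp; ring
  have hid2 : -(s ^ 2 * ((0 + (-0 * (c₁ / s) + (1 - 0) * (-(c₁ / s ^ 2)))) * ηs + (0 + (1 - 0) * (c₁ / s)) * η'))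
      = c₁ * ηs - c₁ * s * η' := by
    field_simp; ring
  rw [hid1, hid2]
  have h1 : -η' ≤ D / (3 * T ^ 2) := (neg_le_abs _).trans hη'b
  refine ⟨?_, by nlinarith [mul_nonneg hc hs0.le], ?_⟩
  · rw [abs_mul, abs_of_nonneg hc]; exact mul_le_mul_of_nonneg_left hη'b hc
  · have h2 : -(c₁ * s * η') ≤ c₁ * (4 * T ^ 2) * (D / (3 * T ^ 2)) := by
      have : c₁ * s * (-η') ≤ c₁ * (4 * T ^ 2) * (D / (3 * T ^ 2)) :=
        mul_le_mul (mul_le_mul_of_nonneg_left hs' hc) h1 (by linarith) (by positivity)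
      linarith
    have h43 : c₁ * (4 * T ^ 2) * (D / (3 * T ^ 2)) = c₁ * (4 * D / 3) := by field_simp
    nlinarith [mul_nonneg hc hη0]

/-- **The primitive `M(s) = ½ ∫_{a}^{s} N`** of a continuous `N`: `M′ = N/2`; if `N` is smooth so is `M`;
if `N = 0` on `[a, ∞)` then `M = 0` there; if `|N| ≤ 4` on `[0, ∞)` and `0 ≤ a` then `|M| ≤ 2a` on `[0, ∞)`.
[folklore] -/
theorem radialPrimitive_props {N : ℝ → ℝ} (hN : ContDiff ℝ (⊤ : ℕ∞) N) {a : ℝ} (ha : 0 ≤ a)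
    (hN0 : ∀ s, a ≤ s → N s = 0) (hN4 : ∀ s, 0 ≤ s → |N s| ≤ 4) :
    ContDiff ℝ (⊤ : ℕ∞) (fun s => 1 / 2 * ∫ σ in a..s, N σ) ∧
    (∀ s, HasDerivAt (fun s => 1 / 2 * ∫ σ in a..s, N σ) (N s / 2) s) ∧
    (∀ s, a ≤ s → (1 / 2 * ∫ σ in a..s, N σ) = 0) ∧
    (∀ s, 0 ≤ s → |1 / 2 * ∫ σ in a..s, N σ| ≤ 2 * a) := by
  have hNc : Continuous N := hN.continuous
  have hMd : ∀ s, HasDerivAt (fun s => 1 / 2 * ∫ σ in a..s, N σ) (N s / 2) s := fun s =>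
    ((hNc.integral_hasStrictDerivAt a s).hasDerivAt.const_mul (1 / 2 : ℝ)).congr_deriv (by ring)
  have hMderiv : deriv (fun s => 1 / 2 * ∫ σ in a..s, N σ) = fun s => N s / 2 := funext fun s => (hMd s).deriv
  refine ⟨?_, hMd, ?_, ?_⟩
  · refine contDiff_infty_iff_deriv.2 ⟨fun s => (hMd s).differentiableAt, ?_⟩
    rw [hMderiv]; exact hN.div_const _
  · intro s hs
    rw [intervalIntegral.integral_congr (g := fun _ => (0 : ℝ)) (fun σ hσ => ?_)]
    · simp
    · rw [uIcc_of_le hs] at hσ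
      exact hN0 σ hσ.1
  · intro s hs
    have hb : ∀ σ ∈ Set.uIoc a s, ‖N σ‖ ≤ 4 := fun σ hσ => by
      rw [Real.norm_eq_abs]
      refine hN4 σ ?_
      rcases le_total a s with h | h
      · rw [uIoc_of_le h] at hσ; exact ha.trans hσ.1.le
      · rw [uIoc_of_ge h] at hσ; exact hs.trans hσ.1.le
    have h1 := intervalIntegral.norm_integral_le_of_norm_le_const hb
    rw [Real.norm_eq_abs] at h1
    rw [abs_mul, abs_of_pos (by norm_num : (0 : ℝ) < 1 / 2)]
    have : |s - a| ≤ max a s := by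
      rcases le_total a s with h | h
      · rw [abs_of_nonneg (by linarith), max_eq_right h]; linarith
      · rw [abs_of_nonpos (by linarith), max_eq_left h]; linarith
    rcases le_total a s with h | h
    · -- `s ≥ a`: the integral vanishes
      have : (∫ σ in a..s, N σ) = 0 := by
        rw [intervalIntegral.integral_congr (g := fun _ => (0 : ℝ)) (fun σ hσ => ?_)]
        · simp
        · rw [uIcc_of_le h] at hσ; exact hN0 σ hσ.1
      rw [this, abs_zero, mul_zero]; positivity
    · have h2 : |s - a| ≤ a := by rw [abs_of_nonpos (by linarith)]; linarith
      nlinarith [abs_nonneg (∫ σ in a..s, N σ)]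

end Summit.NavierStokesRegularity.NavierStokesRegularity.Theorems.GaldiLiouville.AllAxesBudget

end
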